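import Literature.Analysis.FluidPDE.ChaeWolfRemovingDSSBounds
import Literature.Analysis.FluidPDE.MildSolution
import Literature.Analysis.UnboundedOperators.HeatExtensionDecay
import HarnessLib

/-!
# Oseen-mild ancient fields with small scale-invariant size vanish (Chae–Wolf 2017, §3 Step 1, substitute)

Analysis/FluidPDE proof file (no definitions).  There is an absolute `ε₀ > 0` such that every field
`u : ℝ → ℝ³ → ℝ³` satisfying the Oseen (mild) identity
`u(t) = e^{(t−s)Δ}u(s) − ∫ₛᵗ∫ K(t − τ, x − y)[u(τ,y), u(τ,y)] dy dτ` for all `s < t < 0` and the bound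
`√(−t)‖u(t, x)‖ ≤ ε₀` for all `t < 0`, `x`, vanishes identically on `t < 0` (`B = sup √(−t)‖u‖` obeys
`B ≤ B/2 + K₀B²`, `K₀` absolute from the Koch–Tataru kernel bound).  No smoothness, divergence or symmetry
hypothesis.  This is the route-independent home of the lemma proved VERBATIM (statement and proof) as
`Summit.….Theorems.SpiralScalingLiouville.eq_zero_of_oseenMild_of_small_typeITime` in
`Summits/…/Theorems/ExtremalTypeIConstantSpiralScalingLiouvilleSmallTypeI.lean` (route ExtremalTypeIConstant), so
that consumers outside that route (the S-door lane's `StrainDoorsTypeIAncientCompactness`, door K5′, N5) can cite it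
without entering the route's theses cone (gate lint `lint.theses-cone`).

## References
* D. Chae, J. Wolf, *Removing discretely self-similar singularities for the 3D Navier–Stokes equations*,
  Comm. PDE 42 (2017) = arXiv:1610.09464, §3 Step 1 (p. 8). [ChaeWolf2017RemovingDSS]
* H. Koch, D. Tataru, Adv. Math. 157 (2001), (14). [KochTataruAdvMath2001]
-/

noncomputable section

open MeasureTheory Set Function Filter Metric Real
open scoped ENNReal NNReal

namespace Literature.Analysis.FluidPDE

/-- **Oseen-mild ancient fields with small scale-invariant size vanish.** There is an absolute
`ε₀ > 0` such that every field `u : ℝ → ℝ³ → ℝ³` satisfying the Oseen (mild) identity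
`u(t) = e^{(t−s)Δ}u(s) − ∫ₛᵗ∫ K(t − τ, x − y)[u(τ,y), u(τ,y)] dy dτ` for all `s < t < 0` and the bound
`√(−t)‖u(t, x)‖ ≤ ε₀` for all `t < 0`, `x`, vanishes identically on `t < 0`: with
`B = sup √(−t)‖u‖`, the identity from `4t` to `t` gives `B ≤ B/2 + K₀B²` (`K₀` absolute, from the
Koch–Tataru kernel bound), so `B = 0` once `K₀ B ≤ ¼`.  No smoothness, divergence or symmetry
hypothesis is used. [cite: ChaeWolf2017RemovingDSS, §3 Step 1 (arXiv:1610.09464 p. 8); KochTataruAdvMath2001, (14)] -/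
theorem eq_zero_of_oseenMild_of_small_typeITime :
    ∃ ε₀ : ℝ, 0 < ε₀ ∧ ∀ {u : ℝ → EuclideanSpace ℝ (Fin 3) → EuclideanSpace ℝ (Fin 3)},
      (∀ s t : ℝ, s < t → t < 0 → ∀ x, u t x = heatFlow (u s) (t - s) x -
        ∫ τ in Ioo s t, ∫ y, oseenKernel (t - τ) (x - y) (u τ y) (u τ y)) →
      (∀ t < 0, ∀ x, √(-t) * ‖u t x‖ ≤ ε₀) → ∀ t < 0, ∀ x, u t x = 0 := by
  obtain ⟨C, hC, hK⟩ := exists_norm_oseenKernel_le (E := (EuclideanSpace ℝ (Fin 3)))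
  set M₀ : ℝ := ∫ w : EuclideanSpace ℝ (Fin 3), (1 + ‖w‖ ^ 2) ^ (-(2 : ℝ)) with hM₀
  have hM₀0 : 0 ≤ M₀ := integral_nonneg fun w => Real.rpow_nonneg (by positivity) _
  set K₀ : ℝ := 4 * C * M₀ with hK₀
  have hK₀0 : 0 ≤ K₀ := by positivity
  set ε : ℝ := 1 / (4 * K₀ + 4) with hε
  have hε0 : 0 < ε := by positivity
  have hKε : K₀ * ε ≤ 1 / 4 := by
    rw [hε, mul_one_div, div_le_iff₀ (by positivity)]
    linarith
  refine ⟨ε, hε0, ?_⟩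
  intro u hmildAll hsmall
  -- the kernel bound in dimension three
  have finrank_R3_real : ((Module.finrank ℝ (EuclideanSpace ℝ (Fin 3)) : ℕ) : ℝ) = 3 := by
    simp
  have hK' : ∀ {τ : ℝ}, 0 < τ → ∀ z a b : (EuclideanSpace ℝ (Fin 3)),
      ‖oseenKernel τ z a b‖ ≤ C * (τ + ‖z‖ ^ 2) ^ (-(2 : ℝ)) * ‖a‖ * ‖b‖ := by
    intro τ hτ z a b
    have h := hK hτ z a b
    rw [finrank_R3_real, show (-(((3 : ℝ) + 1) / 2)) = -(2 : ℝ) by norm_num] at h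
    exact h
  -- the scale-invariant supremum `B`
  set S : Set ℝ := {r | ∃ t : ℝ, t < 0 ∧ ∃ x : EuclideanSpace ℝ (Fin 3), r = √(-t) * ‖u t x‖}
    with hS
  have hSb : BddAbove S := ⟨ε, by rintro r ⟨t, ht, x, rfl⟩; exact hsmall t ht x⟩
  have hSn : S.Nonempty := ⟨_, -1, by norm_num, 0, rfl⟩
  set B : ℝ := sSup S with hB
  have hqB : ∀ t < 0, ∀ x, √(-t) * ‖u t x‖ ≤ B := fun t ht x =>
    le_csSup hSb ⟨t, ht, x, rfl⟩
  have hBε : B ≤ ε := csSup_le hSn (by rintro r ⟨t, ht, x, rfl⟩; exact hsmall t ht x)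
  have hB0 : 0 ≤ B := le_trans (by positivity) (hqB (-1) (by norm_num) 0)
  have hptw : ∀ σ < 0, ∀ y, ‖u σ y‖ ≤ B / √(-σ) := by
    intro σ hσ y
    have hs : 0 < √(-σ) := Real.sqrt_pos.2 (by linarith)
    rw [le_div_iff₀ hs, mul_comm]
    exact hqB σ hσ y
  -- the key estimate `√(-t) ‖u(t, x)‖ ≤ B/2 + K₀ B²`
  have hkey : ∀ t < 0, ∀ x, √(-t) * ‖u t x‖ ≤ B / 2 + K₀ * B ^ 2 := by
    intro t ht x
    set r : ℝ := √(-t) with hr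
    have hr0 : 0 < r := Real.sqrt_pos.2 (by linarith)
    have hr2 : r ^ 2 = -t := Real.sq_sqrt (by linarith)
    -- the mild identity between `4t` and `t`
    have hmild := hmildAll (4 * t) t (by linarith) ht x
    have h3t : 0 < t - 4 * t := by linarith
    rw [heatFlow_of_pos _ h3t] at hmild
    -- the caloric term
    have hheat :
        ‖UnboundedOperators.heatExtension (u (4 * t)) (t - 4 * t) x‖ ≤ B / (2 * r) := by
      have hb : ∀ z, ‖u (4 * t) z‖ ≤ B / (2 * r) := by
        intro z
        have := hptw (4 * t) (by linarith) z
        rwa [ChaeWolf.sqrt_neg_four_mul, ← hr] at this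
      exact UnboundedOperators.norm_heatExtension_le_of_bound hb h3t x
    -- the Duhamel term
    have hduh : ‖∫ σ in Ioo (4 * t) t, ∫ y, oseenKernel (t - σ) (x - y) (u σ y) (u σ y)‖ ≤
        K₀ * B ^ 2 / r := by
      have hG : IntegrableOn (fun σ : ℝ => C * M₀ * (B ^ 2 / r ^ 2) * (t - σ) ^ (-(1 / 2 : ℝ)))
          (Ioo (4 * t) t) := (ChaeWolf.integrableOn_rpow_sub ht).const_mul _
      have hpt : ∀ᵐ σ ∂(volume.restrict (Ioo (4 * t) t)),
          ‖∫ y, oseenKernel (t - σ) (x - y) (u σ y) (u σ y)‖ ≤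
            C * M₀ * (B ^ 2 / r ^ 2) * (t - σ) ^ (-(1 / 2 : ℝ)) := by
        refine ae_restrict_of_forall_mem measurableSet_Ioo fun σ hσ => ?_
        have hσ0 : σ < 0 := hσ.2.trans ht
        have hτ : 0 < t - σ := by linarith [hσ.2]
        have h1 := ChaeWolf.norm_integral_oseenKernel_le hK' hC.le hτ x (hptw σ hσ0)
        refine h1.trans ?_
        have hsq : (B / √(-σ)) ^ 2 = B ^ 2 / (-σ) := by
          rw [div_pow, Real.sq_sqrt (by linarith)]
        rw [hsq]
        have hw0 : 0 ≤ (t - σ) ^ (-(1 / 2 : ℝ)) := Real.rpow_nonneg (by linarith [hσ.2]) _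
        have hfrac : B ^ 2 / (-σ) ≤ B ^ 2 / r ^ 2 := by
          rw [hr2]
          exact div_le_div_of_nonneg_left (sq_nonneg B) (by linarith) (by linarith [hσ.2])
        calc C * M₀ * (t - σ) ^ (-(1 / 2 : ℝ)) * (B ^ 2 / -σ)
            ≤ C * M₀ * (t - σ) ^ (-(1 / 2 : ℝ)) * (B ^ 2 / r ^ 2) := by gcongr
          _ = C * M₀ * (B ^ 2 / r ^ 2) * (t - σ) ^ (-(1 / 2 : ℝ)) := by ring
      refine (norm_integral_le_of_norm_le hG hpt).trans ?_
      rw [MeasureTheory.integral_const_mul, ChaeWolf.integral_rpow_sub ht]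
      have h3 := ChaeWolf.sqrt_neg_three_mul_le t ht
      rw [← hr] at h3
      have hrr : r ^ 2 = r * r := sq r
      calc C * M₀ * (B ^ 2 / r ^ 2) * (2 * √(-(3 * t)))
          ≤ C * M₀ * (B ^ 2 / r ^ 2) * (2 * (2 * r)) := by gcongr
        _ = K₀ * B ^ 2 / r := by
            rw [hK₀, hrr]
            field_simp
            ring
    -- assemble
    have hnorm : ‖u t x‖ ≤ B / (2 * r) + K₀ * B ^ 2 / r := by
      rw [hmild]
      exact (norm_sub_le _ _).trans (add_le_add hheat hduh)
    calc r * ‖u t x‖ ≤ r * (B / (2 * r) + K₀ * B ^ 2 / r) := by gcongr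
      _ = B / 2 + K₀ * B ^ 2 := by field_simp
  -- bootstrap: `B ≤ B/2 + K₀ B²` and `B ≤ ε` force `B = 0`
  have hB1 : B ≤ B / 2 + K₀ * B ^ 2 :=
    csSup_le hSn (by rintro r ⟨t, ht, x, rfl⟩; exact hkey t ht x)
  have hB2 : K₀ * B ^ 2 ≤ B / 4 := by
    calc K₀ * B ^ 2 = (K₀ * B) * B := by ring
      _ ≤ (K₀ * ε) * B := by gcongr
      _ ≤ (1 / 4) * B := by gcongr
      _ = B / 4 := by ring
  have hB00 : B ≤ 0 := by linarith
  intro t ht x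
  have hst : 0 < √(-t) := Real.sqrt_pos.2 (by linarith)
  have h := hqB t ht x
  have h' : √(-t) * ‖u t x‖ ≤ 0 := h.trans hB00
  have hn : ‖u t x‖ ≤ 0 := by
    by_contra hcon
    push Not at hcon
    have : 0 < √(-t) * ‖u t x‖ := mul_pos hst hcon
    linarith
  exact norm_le_zero_iff.1 hn

end Literature.Analysis.FluidPDE

end
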